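import Summits.AtomisticToContinuum.Crystallization.Theorems.ExcessDecayLiouvillePhononStabilityDefs
import Summits.AtomisticToContinuum.Crystallization.Theorems.ExcessDecayLiouvillePhononStabilityLabels

/-!
# `PhononStability` (stmt-AtomisticToContinuum-9333), line `contragredient-window-collapse`: stub `stub_window`

Reduction S2 of the line (`WindowGeometry`, the bond graph and the bond lengths on the window): for a window
cell `A` (`CellWindow A`: stretches in `[189/200, 199/200]`) and a shift error `δ` (`ShiftWindow A δ`:
`‖Aδ‖ ≤ 1/40`),

* the metric bond graph `‖Aζ_c(δ)‖ ≤ 11/10` over non-diagonal classes `c` IS the set `nnClasses` of the 24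
  reference nearest-neighbour classes;
* nearest-neighbour lengths lie in `[23/25, 511/500]`, the in-plane (intra-sublattice) ones in
  `[189/200, 199/200]`;
* every other non-diagonal class has length `≥ 131/100`.

The reference geometry enters through the integer quadratic form of the hcp two-lattice: for
`c = (m, m', n)` and `s = σ(m') − σ(m) ∈ {−1, 0, 1}`,
`36‖ζ⁰_c‖² = 9(2n₀ + n₁ + s)² + 3(3n₁ + s)² + 24(2n₂ + s)²`, which is `36` exactly on `nnClasses`, `0` on the
diagonal class and `≥ 72` otherwise (integer casework); the window bounds then follow from
`ζ_c(δ) = ζ⁰_c + s·δ`, `‖δ‖ ≤ 5/189` and `(189/200)(√2 − 5/189) ≥ 131/100`.  All `[folklore]`.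
-/

noncomputable section

open scoped BigOperators Classical InnerProductSpace
open Filter Set Function
open Literature.MathematicalPhysics.StatisticalMechanics
open Summit.AtomisticToContinuum.Crystallization.Theses.ExcessDecayLiouville
open Summit.AtomisticToContinuum.Crystallization.Theorems.PhononStabilityNegative
open Summit.AtomisticToContinuum.Crystallization.Theorems.PhononStabilityCWC

namespace Summit.AtomisticToContinuum.Crystallization.Theorems.PhononStabilityCWC.WindowStub

/-! ## Copies of the line's Basics lemmas (not yet in the tree) -/

/-- `refPos δ (m, n) = latVec n + σ(m)·(innerRef + δ)`; copy of the line's Basics lemma. [folklore] -/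
private theorem refPos_eq (δ : EuclideanSpace ℝ (Fin 3)) (ℓ : Label) :
    refPos δ ℓ = latVec ℓ.2 + subSign ℓ.1 • (innerRef + δ) := by
  unfold refPos subSign
  split_ifs <;> simp

/-- `ζ_c(δ) = ζ⁰_c + (σ(m') − σ(m))·δ`; copy of the line's Basics lemma. [folklore] -/
private theorem bondVec_eq (δ : EuclideanSpace ℝ (Fin 3)) (c : BondClass) :
    bondVec δ c = bondVec 0 c + (subSign c.2.1 - subSign c.1) • δ := by
  simp only [bondVec, refPos_eq, smul_add, sub_smul, add_zero]
  abel

/-- `|σ(m') − σ(m)| ≤ 1`; copy of the line's Basics lemma. [folklore] -/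
private theorem abs_subSign_sub_le (m m' : Fin 2) : |subSign m' - subSign m| ≤ 1 := by
  unfold subSign
  split_ifs <;> norm_num

/-- Shift bound `‖δ‖ ≤ 5/189` from `‖Aδ‖ ≤ 1/40` and the lower stretch; copy of the line's Basics lemma.
[folklore] -/
private theorem norm_shift_le {A : EuclideanSpace ℝ (Fin 3) →L[ℝ] EuclideanSpace ℝ (Fin 3)}
    {δ : EuclideanSpace ℝ (Fin 3)} (hW : CellWindow A) (hδ : ShiftWindow A δ) : ‖δ‖ ≤ 5 / 189 := by
  have h1 := (hW δ).1
  unfold ShiftWindow at hδ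
  linarith

/-! ## The integer quadratic form of the reference lengths -/

/-- `ζ⁰_{(m,m',n)} = latVec n + (σ(m') − σ(m))·innerRef`. [folklore] -/
theorem bondVec_zero_eq (m m' : Fin 2) (n : Fin 3 → ℤ) :
    bondVec 0 (m, m', n) = latVec n + (subSign m' - subSign m) • innerRef := by
  have h0 : latVec 0 = 0 := by simp [latVec]
  simp only [bondVec, refPos_eq, add_zero, h0, zero_add, sub_smul]
  abel

/-- **Reference lengths in coordinates:** for `c = (m, m', n)` and `s = σ(m') − σ(m)`,
`36‖ζ⁰_c‖² = 9(2n₀ + n₁ + s)² + 3(3n₁ + s)² + 24(2n₂ + s)²`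
(`ζ⁰_c = (n₀ + n₁/2 + s/2, (n₁/2 + s/6)√3, (2n₂ + s)√(2/3))`). [folklore] -/
theorem norm_sq_bondVec_zero (m m' : Fin 2) (n : Fin 3 → ℤ) :
    36 * ‖bondVec 0 (m, m', n)‖ ^ 2 =
      9 * (2 * (n 0 : ℝ) + n 1 + (subSign m' - subSign m)) ^ 2 +
        3 * (3 * (n 1 : ℝ) + (subSign m' - subSign m)) ^ 2 +
          24 * (2 * (n 2 : ℝ) + (subSign m' - subSign m)) ^ 2 := by
  obtain ⟨a0, a1, a2⟩ := LabelsStub.latVec_apply n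
  obtain ⟨b0, b1, b2⟩ := LabelsStub.innerRef_apply
  have h3 : (√3 : ℝ) ^ 2 = 3 := Real.sq_sqrt (by norm_num)
  have h23 : (√(2 / 3) : ℝ) ^ 2 = 2 / 3 := Real.sq_sqrt (by norm_num)
  rw [bondVec_zero_eq, EuclideanSpace.real_norm_sq_eq, Fin.sum_univ_three, PiLp.add_apply, PiLp.add_apply,
    PiLp.add_apply, PiLp.smul_apply, PiLp.smul_apply, PiLp.smul_apply, smul_eq_mul, smul_eq_mul, smul_eq_mul,
    a0, a1, a2, b0, b1, b2]
  linear_combination (3 * (n 1 : ℝ) + (subSign m' - subSign m)) ^ 2 * h3 +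
    36 * (2 * (n 2 : ℝ) + (subSign m' - subSign m)) ^ 2 * h23

/-! ## Integer casework -/

/-- Intra-sublattice casework (`s = 0`): `9(2a + b)² + 27b² + 96k² < 72` over `ℤ` only for `(a, b, k) = 0`
or one of the six in-plane nearest neighbours `±(1,0,0), ±(0,1,0), ±(1,−1,0)`. [folklore] -/
theorem int_cases_zero (a b k : ℤ)
    (h : 9 * ((2 * a + b) * (2 * a + b)) + 27 * (b * b) + 96 * (k * k) < 72) :
    (a = 0 ∧ b = 0 ∧ k = 0) ∨ (a = 1 ∧ b = 0 ∧ k = 0) ∨ (a = -1 ∧ b = 0 ∧ k = 0) ∨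
      (a = 0 ∧ b = 1 ∧ k = 0) ∨ (a = 0 ∧ b = -1 ∧ k = 0) ∨ (a = 1 ∧ b = -1 ∧ k = 0) ∨
        (a = -1 ∧ b = 1 ∧ k = 0) := by
  have hX := mul_self_nonneg (2 * a + b)
  have hY := mul_self_nonneg b
  have hZ := mul_self_nonneg k
  have hk1 : k ≤ 0 := by
    by_contra hc
    nlinarith [mul_self_nonneg (k - 1)]
  have hk2 : 0 ≤ k := by
    by_contra hc
    nlinarith [mul_self_nonneg (k + 1)]
  have hb1 : b ≤ 1 := by
    by_contra hc
    nlinarith [mul_self_nonneg (b - 2)]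
  have hb2 : -1 ≤ b := by
    by_contra hc
    nlinarith [mul_self_nonneg (b + 2)]
  have ha1 : a ≤ 1 := by
    by_contra hc
    nlinarith [mul_self_nonneg (2 * a + b - 3)]
  have ha2 : -1 ≤ a := by
    by_contra hc
    nlinarith [mul_self_nonneg (2 * a + b + 3)]
  interval_cases a <;> interval_cases b <;> interval_cases k <;> omega

/-- Inter-sublattice casework (`s = 1`, bonds from sublattice `0` to sublattice `1`):
`9(2a + b + 1)² + 3(3b + 1)² + 24(2k + 1)² < 72` over `ℤ` only for the six nearest neighbours
`(0,0,0), (−1,0,0), (0,−1,0), (0,0,−1), (−1,0,−1), (0,−1,−1)`. [folklore] -/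
theorem int_cases_one (a b k : ℤ)
    (h : 9 * ((2 * a + b + 1) * (2 * a + b + 1)) + 3 * ((3 * b + 1) * (3 * b + 1)) +
      24 * ((2 * k + 1) * (2 * k + 1)) < 72) :
    (a = 0 ∧ b = 0 ∧ k = 0) ∨ (a = -1 ∧ b = 0 ∧ k = 0) ∨ (a = 0 ∧ b = -1 ∧ k = 0) ∨
      (a = 0 ∧ b = 0 ∧ k = -1) ∨ (a = -1 ∧ b = 0 ∧ k = -1) ∨ (a = 0 ∧ b = -1 ∧ k = -1) := by
  have hX := mul_self_nonneg (2 * a + b + 1)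
  have hY := mul_self_nonneg (3 * b + 1)
  have hZ := mul_self_nonneg (2 * k + 1)
  have hk1 : k ≤ 0 := by
    by_contra hc
    nlinarith [mul_self_nonneg (2 * k + 1 - 3)]
  have hk2 : -1 ≤ k := by
    by_contra hc
    nlinarith [mul_self_nonneg (2 * k + 1 + 3)]
  have hb1 : b ≤ 1 := by
    by_contra hc
    nlinarith [mul_self_nonneg (3 * b + 1 - 7)]
  have hb2 : -1 ≤ b := by
    by_contra hc
    nlinarith [mul_self_nonneg (3 * b + 1 + 5)]
  have ha1 : a ≤ 1 := by
    by_contra hc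
    nlinarith [mul_self_nonneg (2 * a + b + 1 - 4)]
  have ha2 : -2 ≤ a := by
    by_contra hc
    nlinarith [mul_self_nonneg (2 * a + b + 1 + 4)]
  interval_cases a <;> interval_cases b <;> interval_cases k <;> omega

/-- Inter-sublattice casework (`s = −1`, bonds from sublattice `1` to sublattice `0`):
`9(2a + b − 1)² + 3(3b − 1)² + 24(2k − 1)² < 72` over `ℤ` only for the six nearest neighbours
`(0,0,0), (1,0,0), (0,1,0), (0,0,1), (1,0,1), (0,1,1)` (the mirror image of `int_cases_one`). [folklore] -/
theorem int_cases_neg_one (a b k : ℤ)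
    (h : 9 * ((2 * a + b - 1) * (2 * a + b - 1)) + 3 * ((3 * b - 1) * (3 * b - 1)) +
      24 * ((2 * k - 1) * (2 * k - 1)) < 72) :
    (a = 0 ∧ b = 0 ∧ k = 0) ∨ (a = 1 ∧ b = 0 ∧ k = 0) ∨ (a = 0 ∧ b = 1 ∧ k = 0) ∨
      (a = 0 ∧ b = 0 ∧ k = 1) ∨ (a = 1 ∧ b = 0 ∧ k = 1) ∨ (a = 0 ∧ b = 1 ∧ k = 1) := by
  have hX := mul_self_nonneg (2 * a + b - 1)
  have hY := mul_self_nonneg (3 * b - 1)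
  have hZ := mul_self_nonneg (2 * k - 1)
  have hk1 : k ≤ 1 := by
    by_contra hc
    nlinarith [mul_self_nonneg (2 * k - 1 - 3)]
  have hk2 : 0 ≤ k := by
    by_contra hc
    nlinarith [mul_self_nonneg (2 * k - 1 + 3)]
  have hb1 : b ≤ 1 := by
    by_contra hc
    nlinarith [mul_self_nonneg (3 * b - 1 - 5)]
  have hb2 : -1 ≤ b := by
    by_contra hc
    nlinarith [mul_self_nonneg (3 * b - 1 + 7)]
  have ha1 : a ≤ 2 := by
    by_contra hc
    nlinarith [mul_self_nonneg (2 * a + b - 1 - 4)]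
  have ha2 : -1 ≤ a := by
    by_contra hc
    nlinarith [mul_self_nonneg (2 * a + b - 1 + 4)]
  interval_cases a <;> interval_cases b <;> interval_cases k <;> omega

/-! ## Classification of the reference lengths -/

/-- Nearest-neighbour classes have reference length `1`: `36‖ζ⁰_c‖² = 36` on `nnClasses`. [folklore] -/
theorem norm_sq_of_mem {c : BondClass} (hc : c ∈ nnClasses) : 36 * ‖bondVec 0 c‖ ^ 2 = 36 := by
  simp only [nnClasses, Finset.mem_insert, Finset.mem_singleton] at hc
  rcases hc with rfl | rfl | rfl | rfl | rfl | rfl | rfl | rfl | rfl | rfl | rfl | rfl | rfl | rfl | rfl | rfl |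
    rfl | rfl | rfl | rfl | rfl | rfl | rfl | rfl <;>
  · rw [norm_sq_bondVec_zero]
    norm_num [subSign, Matrix.cons_val_two, Matrix.tail_cons, Matrix.head_cons]

/-- **Short reference bonds are the diagonal or nearest neighbours:** `36‖ζ⁰_c‖² < 72` forces `c` to be the
diagonal class or one of the 24 classes of `nnClasses`. [folklore] -/
theorem diag_or_mem_of_lt {c : BondClass} (h : 36 * ‖bondVec 0 c‖ ^ 2 < 72) :
    diagClass c ∨ c ∈ nnClasses := by
  obtain ⟨m, m', n⟩ := c
  obtain ⟨a, b, k, rfl⟩ : ∃ a b k : ℤ, n = ![a, b, k] := ⟨n 0, n 1, n 2, by ext i; fin_cases i <;> rfl⟩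
  rw [norm_sq_bondVec_zero] at h
  simp only [Matrix.cons_val_zero, Matrix.cons_val_one, Matrix.cons_val] at h
  fin_cases m <;> fin_cases m' <;> simp only [subSign, Fin.zero_eta, Fin.mk_one, Fin.isValue] at h ⊢
  · -- `(0, 0, n)`: `s = 0`
    have hz : 9 * ((2 * a + b) * (2 * a + b)) + 27 * (b * b) + 96 * (k * k) < 72 := by
      have h' : ((9 * ((2 * a + b) * (2 * a + b)) + 27 * (b * b) + 96 * (k * k) : ℤ) : ℝ) < 72 := by
        push_cast
        norm_num at h
        linarith
      exact_mod_cast h'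
    rcases int_cases_zero a b k hz with ⟨rfl, rfl, rfl⟩ | ⟨rfl, rfl, rfl⟩ | ⟨rfl, rfl, rfl⟩ | ⟨rfl, rfl, rfl⟩ |
      ⟨rfl, rfl, rfl⟩ | ⟨rfl, rfl, rfl⟩ | ⟨rfl, rfl, rfl⟩
    · left; exact ⟨rfl, by decide⟩
    all_goals right; decide
  · -- `(0, 1, n)`: `s = 1`
    have hz : 9 * ((2 * a + b + 1) * (2 * a + b + 1)) + 3 * ((3 * b + 1) * (3 * b + 1)) +
        24 * ((2 * k + 1) * (2 * k + 1)) < 72 := by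
      have h' : ((9 * ((2 * a + b + 1) * (2 * a + b + 1)) + 3 * ((3 * b + 1) * (3 * b + 1)) +
          24 * ((2 * k + 1) * (2 * k + 1)) : ℤ) : ℝ) < 72 := by
        push_cast
        norm_num at h
        linarith
      exact_mod_cast h'
    rcases int_cases_one a b k hz with ⟨rfl, rfl, rfl⟩ | ⟨rfl, rfl, rfl⟩ | ⟨rfl, rfl, rfl⟩ | ⟨rfl, rfl, rfl⟩ |
      ⟨rfl, rfl, rfl⟩ | ⟨rfl, rfl, rfl⟩
    all_goals right; decide
  · -- `(1, 0, n)`: `s = -1`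
    have hz : 9 * ((2 * a + b - 1) * (2 * a + b - 1)) + 3 * ((3 * b - 1) * (3 * b - 1)) +
        24 * ((2 * k - 1) * (2 * k - 1)) < 72 := by
      have h' : ((9 * ((2 * a + b - 1) * (2 * a + b - 1)) + 3 * ((3 * b - 1) * (3 * b - 1)) +
          24 * ((2 * k - 1) * (2 * k - 1)) : ℤ) : ℝ) < 72 := by
        push_cast
        norm_num at h
        linarith
      exact_mod_cast h'
    rcases int_cases_neg_one a b k hz with ⟨rfl, rfl, rfl⟩ | ⟨rfl, rfl, rfl⟩ | ⟨rfl, rfl, rfl⟩ |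
      ⟨rfl, rfl, rfl⟩ | ⟨rfl, rfl, rfl⟩ | ⟨rfl, rfl, rfl⟩
    all_goals right; decide
  · -- `(1, 1, n)`: `s = 0`
    have hz : 9 * ((2 * a + b) * (2 * a + b)) + 27 * (b * b) + 96 * (k * k) < 72 := by
      have h' : ((9 * ((2 * a + b) * (2 * a + b)) + 27 * (b * b) + 96 * (k * k) : ℤ) : ℝ) < 72 := by
        push_cast
        norm_num at h
        linarith
      exact_mod_cast h'
    rcases int_cases_zero a b k hz with ⟨rfl, rfl, rfl⟩ | ⟨rfl, rfl, rfl⟩ | ⟨rfl, rfl, rfl⟩ | ⟨rfl, rfl, rfl⟩ |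
      ⟨rfl, rfl, rfl⟩ | ⟨rfl, rfl, rfl⟩ | ⟨rfl, rfl, rfl⟩
    · left; exact ⟨rfl, by decide⟩
    all_goals right; decide

/-- Nearest-neighbour classes have `‖ζ⁰_c‖ = 1`. [folklore] -/
theorem norm_bondVec_zero_of_mem {c : BondClass} (hc : c ∈ nnClasses) : ‖bondVec 0 c‖ = 1 := by
  have h := norm_sq_of_mem hc
  have h0 := norm_nonneg (bondVec 0 c)
  nlinarith

/-- Non-diagonal classes outside `nnClasses` have `‖ζ⁰_c‖² ≥ 2` (next shell `√2`). [folklore] -/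
theorem two_le_norm_sq {c : BondClass} (hd : ¬ diagClass c) (hc : c ∉ nnClasses) :
    2 ≤ ‖bondVec 0 c‖ ^ 2 := by
  by_contra h
  rcases diag_or_mem_of_lt (c := c) (by linarith) with h' | h'
  exacts [hd h', hc h']

/-! ## The stub -/

/-- **S2 — WINDOW GEOMETRY** (`stub_window`): on the window the metric bond graph `‖Aζ_c(δ)‖ ≤ 11/10` is the
reference nearest-neighbour graph `nnClasses`, nearest-neighbour lengths lie in `[23/25, 511/500]` (in-plane
ones in `[189/200, 199/200]`), all other non-diagonal lengths are `≥ 131/100`. [folklore] -/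
theorem stub_window : WindowGeometry := by
  intro A δ hW hδ
  have hAδ : ‖A δ‖ ≤ 1 / 40 := hδ
  -- nearest neighbours: `ζ = ζ⁰ + s·δ`, `‖ζ⁰‖ = 1`
  have hNN : ∀ c ∈ nnClasses, 23 / 25 ≤ ‖A (bondVec δ c)‖ ∧ ‖A (bondVec δ c)‖ ≤ 511 / 500 := by
    intro c hc
    have h1 : ‖bondVec 0 c‖ = 1 := norm_bondVec_zero_of_mem hc
    have hW0 := hW (bondVec 0 c)
    rw [h1, mul_one, mul_one] at hW0
    have heq : A (bondVec δ c) = A (bondVec 0 c) + (subSign c.2.1 - subSign c.1) • A δ := by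
      rw [bondVec_eq δ c, map_add, map_smul]
    have hsm : ‖(subSign c.2.1 - subSign c.1) • A δ‖ ≤ 1 / 40 := by
      rw [norm_smul, Real.norm_eq_abs]
      calc |subSign c.2.1 - subSign c.1| * ‖A δ‖ ≤ 1 * ‖A δ‖ :=
            mul_le_mul_of_nonneg_right (abs_subSign_sub_le _ _) (norm_nonneg _)
        _ ≤ 1 / 40 := by rw [one_mul]; exact hAδ
    have hup : ‖A (bondVec δ c)‖ ≤ ‖A (bondVec 0 c)‖ + ‖(subSign c.2.1 - subSign c.1) • A δ‖ := by
      rw [heq]; exact norm_add_le _ _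
    have hlow : ‖A (bondVec 0 c)‖ ≤ ‖A (bondVec δ c)‖ + ‖(subSign c.2.1 - subSign c.1) • A δ‖ := by
      rw [heq]; exact norm_le_add_norm_add _ _
    constructor <;> linarith [hW0.1, hW0.2]
  -- the other classes: `‖ζ⁰‖ ≥ √2`, `‖ζ‖ ≥ √2 − 5/189`, `‖Aζ‖ ≥ 0.945(√2 − 5/189) ≥ 1.31`
  have hfar : ∀ c : BondClass, ¬ diagClass c → c ∉ nnClasses → 131 / 100 ≤ ‖A (bondVec δ c)‖ := by
    intro c hd hc
    have h2 : 2 ≤ ‖bondVec 0 c‖ ^ 2 := two_le_norm_sq hd hc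
    have h0 := norm_nonneg (bondVec 0 c)
    have h3 : 89 / 63 ≤ ‖bondVec 0 c‖ := by nlinarith
    have h4 : ‖bondVec 0 c‖ - ‖bondVec δ c - bondVec 0 c‖ ≤ ‖bondVec δ c‖ := by
      have := norm_sub_norm_le (bondVec 0 c) (bondVec 0 c - bondVec δ c)
      rwa [sub_sub_cancel, norm_sub_rev (bondVec 0 c)] at this
    have h5 : ‖bondVec δ c - bondVec 0 c‖ ≤ ‖δ‖ := by
      rw [bondVec_eq δ c, add_sub_cancel_left, norm_smul, Real.norm_eq_abs]
      calc |subSign c.2.1 - subSign c.1| * ‖δ‖ ≤ 1 * ‖δ‖ :=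
            mul_le_mul_of_nonneg_right (abs_subSign_sub_le _ _) (norm_nonneg _)
        _ = ‖δ‖ := one_mul _
    have h6 : ‖δ‖ ≤ 5 / 189 := norm_shift_le hW hδ
    have h7 := (hW (bondVec δ c)).1
    linarith
  refine ⟨fun c hd => ⟨fun hc => ?_, fun hle => ?_⟩, hNN, fun c hc hintra => ?_, hfar⟩
  · linarith [(hNN c hc).2]
  · by_contra hc
    linarith [hfar c hd hc]
  · have h1 : ‖bondVec 0 c‖ = 1 := norm_bondVec_zero_of_mem hc
    have hW0 := hW (bondVec 0 c)
    rw [h1, mul_one, mul_one] at hW0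
    have heq : bondVec δ c = bondVec 0 c := by
      rw [bondVec_eq δ c, hintra, sub_self, zero_smul, add_zero]
    rw [heq]
    exact hW0

end Summit.AtomisticToContinuum.Crystallization.Theorems.PhononStabilityCWC.WindowStub

end
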